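import Summits.HodgeConjecture.HodgeConjecture.Theorems.MarkmanPartnerTransportPartnerExistenceInverse
import Literature.AlgebraicGeometry.Surfaces.K3HodgeTypesHolds
import Literature.AlgebraicGeometry.Surfaces.K3HodgeTypesProofs
import Literature.AlgebraicGeometry.HodgeTheory.LefschetzOneOneHolds
import Literature.AlgebraicGeometry.HodgeTheory.AlgebraicClassesHodgeTypeHolds

/-!
# Route MarkmanPartnerTransport · support `PartnerExistence` (stmt-HodgeConjecture-19655) —
# the K3 side: Néron–Severi and transcendental classes of the marked partner

Let `S` be a K3 surface with a marking `(η, p, x)` (integral classes `↔ ℤ²²`, cup product `= ( . ) • p`,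
`p ≠ 0`, `η⁻¹ x` spanning `H^{2,0}`), and let `W ⊆ Λ_ℚ = ℚ²²` be a rational subspace with `x, x̄ ∈ W ⊗ ℂ`,
complementary to `M = W^⊥`, and IRREDUCIBLE for `x` in the sense that a vector of `W` orthogonal to `x`
is zero (for the partner construction: `W = F(T(X)_ℚ)`, irreducibility transported from
`eq_zero_of_mem_ratTransc_of_orthogonal_period`).  Then, using the tree's K3 Hodge types
(`Huybrechts_K3_hodgeTypes_H2_holds`), Lefschetz `(1,1)` and the rational spanning of `N¹`:

* `oneOne_iff_of_marking`, `zeroTwo_iff_of_marking` — `(1,1) ⟺ ⊥ x, x̄`; `(0,2) ⟺ ∈ ℂ η⁻¹x̄`;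
* `ratCast_mem_orthogonal_of_k3Form_period` — a rational vector `⊥ x` lies in `M`;
* `eta_algebraic_mem_span_orthogonal` — **`η(N¹(S)) ⊆ M ⊗ ℂ`**;
* `symm_ratCast_mem_algebraicClasses` — **`η⁻¹(M) ⊆ N¹(S)`** (Lefschetz `(1,1)`);
* `eta_mem_span_of_cupTransc`, `cupTransc_of_eta_mem_span` — **`a` is cup-transcendental iff `η a ∈ W ⊗ ℂ`**;
* `le_finrank_algebraicClasses_of_marking` — `dim_ℚ M ≤ ρ(S)`.

No definition, no sorry, no named fact. Prover seat hodge-nonav-19652-p1 (gen 5), `--supports stmt-HodgeConjecture-19655`.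

References: D. Huybrechts, *Lectures on K3 Surfaces*, Ch. 1 Prop. 3.5, Ch. 3 Def. 2.5 / Lemma 3.1, Ch. 6
Prop. 1.2; C. Voisin, *Hodge Theory I*, §7.1.1 and Thm. 11.30.
-/

noncomputable section

set_option linter.dupNamespace false

open scoped Matrix
open Module CategoryTheory
open Literature.AlgebraicTopology.SingularHomology Literature.Geometry.Kaehler
open Literature.AlgebraicGeometry Literature.AlgebraicGeometry.Motives Literature.AlgebraicGeometry.HodgeTheory
open Literature.AlgebraicGeometry.Hyperkaehler Literature.AlgebraicGeometry.Surfaces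
open Summit.HodgeConjecture.HodgeConjecture.Theorems.NikulinTwinTransport
open Summit.HodgeConjecture.HodgeConjecture.Theorems.AnchorExistenceCMFloor

namespace Summit.HodgeConjecture.HodgeConjecture.Theorems.MarkmanPartnerTransport.PartnerLattice

variable {S : SchemeOver ℂ} {η : complexBetti S (2 * 1) ≃ₗ[ℂ] (K3Index → ℂ)} {p : complexBetti S (2 * 2)}
  {x : K3Index → ℂ} {W : Submodule ℚ (K3Index → ℚ)}

/-! ### Hodge types of the marked K3 surface in terms of the period -/

/-- The period is non-zero (`Re (x̄.x) > 0`). [cite: Huybrechts2016K3, Ch. 6 Prop. 1.2] -/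
theorem period_ne_zero (hxpos : 0 < (k3Form (star x) x).re) : x ≠ 0 := by
  rintro rfl
  simp [k3Form] at hxpos

/-- `σ = η⁻¹ x ≠ 0`. [cite: Huybrechts2016K3, Ch. 6 Prop. 1.2] -/
theorem sigma_ne_zero (hxpos : 0 < (k3Form (star x) x).re) : η.symm x ≠ 0 := by
  intro h
  exact period_ne_zero hxpos (by simpa using congrArg η h)

/-- **`(1,1)`-classes of the marked K3 are the classes `⊥ x, x̄`** (`Huybrechts_K3_hodgeTypes_H2_holds`,
cup product `= ( . ) • p`, `p ≠ 0`, `σ̄ = η⁻¹ x̄`). [cite: Huybrechts2016K3, Ch. 6 Prop. 1.2 (iii)] -/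
theorem oneOne_iff_of_marking (hS : IsK3Surface S) (hp0 : p ≠ 0)
    (hη : ∀ c : complexBetti S (2 * 1), IsIntegralClass c ↔ ∃ v : K3Index → ℤ, η c = fun i => (v i : ℂ))
    (hcup : ∀ a b : complexBetti S (2 * 1), cupProduct (rfl : 2 * 1 + 2 * 1 = 2 * 2) a b = k3Form (η a) (η b) • p)
    (h20 : IsOfHodgeType 2 S (2 * 1) 2 0 (η.symm x)) (hxpos : 0 < (k3Form (star x) x).re)
    (c : complexBetti S (2 * 1)) :
    IsOfHodgeType 2 S (2 * 1) 1 1 c ↔ k3Form (η c) x = 0 ∧ k3Form (η c) (star x) = 0 := by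
  have h := (Huybrechts_K3_hodgeTypes_H2_holds S hS (η.symm x) h20 (sigma_ne_zero hxpos)).2.2 c
  rw [h, conjClass_markingSymm η hη x, hcup, hcup, LinearEquiv.apply_symm_apply, LinearEquiv.apply_symm_apply,
    smul_eq_zero, smul_eq_zero, or_iff_left hp0, or_iff_left hp0]

/-- **`(0,2)`-classes of the marked K3 are the multiples of `η⁻¹ x̄`.** [cite: Huybrechts2016K3, Ch. 6 Prop. 1.2] -/
theorem zeroTwo_iff_of_marking (hS : IsK3Surface S)
    (hη : ∀ c : complexBetti S (2 * 1), IsIntegralClass c ↔ ∃ v : K3Index → ℤ, η c = fun i => (v i : ℂ))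
    (h20 : IsOfHodgeType 2 S (2 * 1) 2 0 (η.symm x)) (hxpos : 0 < (k3Form (star x) x).re)
    (c : complexBetti S (2 * 1)) :
    IsOfHodgeType 2 S (2 * 1) 0 2 c ↔ ∃ t : ℂ, c = t • η.symm (star x) := by
  have h := (Huybrechts_K3_hodgeTypes_H2_holds S hS (η.symm x) h20 (sigma_ne_zero hxpos)).2.1 c
  rw [h, conjClass_markingSymm η hη x]

/-! ### Rational vectors orthogonal to the period lie in `M = W^⊥` -/

/-- **A rational vector `⊥ x` lies in `W^⊥`** (decompose along `Λ_ℚ = W ⊕ W^⊥`; the `W`-component is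
`⊥ x`, hence zero by irreducibility). [cite: Huybrechts2016K3, Ch. 3 Lemma 3.1] -/
theorem ratCast_mem_orthogonal_of_k3Form_period (hWc : IsCompl W (k3FormRat.orthogonal W))
    (hx : x ∈ Submodule.span ℂ ((fun a : K3Index → ℚ => fun i => (a i : ℂ)) '' (W : Set (K3Index → ℚ))))
    (hirr : ∀ w ∈ W, k3Form (fun i => (w i : ℂ)) x = 0 → w = 0)
    {v : K3Index → ℚ} (hv : k3Form (fun i => (v i : ℂ)) x = 0) : v ∈ k3FormRat.orthogonal W := by
  have hvtop : v ∈ W ⊔ k3FormRat.orthogonal W := by rw [hWc.sup_eq_top]; exact Submodule.mem_top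
  obtain ⟨w₀, hw₀, m₀, hm₀, rfl⟩ := Submodule.mem_sup.1 hvtop
  have hm : k3Form (fun i => (m₀ i : ℂ)) x = 0 :=
    k3Form_eq_zero_of_mem_span W (k3FormRat.orthogonal W)
      (fun m hm w hw => by rw [k3FormRat_isSymm.eq]; exact (LinearMap.BilinForm.mem_orthogonal_iff.1 hm) w hw)
      (Submodule.subset_span ⟨m₀, hm₀, rfl⟩) hx
  have hw : k3Form (fun i => (w₀ i : ℂ)) x = 0 := by
    have h : (fun i => ((w₀ + m₀) i : ℂ)) = (fun i => (w₀ i : ℂ)) + fun i => (m₀ i : ℂ) := ratCastVec_add w₀ m₀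
    rw [h, k3Form_add_left, hm, add_zero] at hv
    exact hv
  rw [hirr w₀ hw₀ hw, zero_add]
  exact hm₀

/-- **`η(N¹(S)) ⊆ W^⊥ ⊗ ℂ`**: `N¹(S)` is spanned by rational classes, which are `(1,1)` hence `⊥ x`, hence
(as rational vectors) in `W^⊥`. [cite: Huybrechts2016K3, Ch. 3 Lemma 3.1] [cite: VoisinHodgeI2002, §7.1.1] -/
theorem eta_algebraic_mem_span_orthogonal (hS : IsK3Surface S) (hp0 : p ≠ 0)
    (hη : ∀ c : complexBetti S (2 * 1), IsIntegralClass c ↔ ∃ v : K3Index → ℤ, η c = fun i => (v i : ℂ))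
    (hcup : ∀ a b : complexBetti S (2 * 1), cupProduct (rfl : 2 * 1 + 2 * 1 = 2 * 2) a b = k3Form (η a) (η b) • p)
    (h20 : IsOfHodgeType 2 S (2 * 1) 2 0 (η.symm x)) (hxpos : 0 < (k3Form (star x) x).re)
    (hWc : IsCompl W (k3FormRat.orthogonal W))
    (hx : x ∈ Submodule.span ℂ ((fun a : K3Index → ℚ => fun i => (a i : ℂ)) '' (W : Set (K3Index → ℚ))))
    (hirr : ∀ w ∈ W, k3Form (fun i => (w i : ℂ)) x = 0 → w = 0)
    {d : complexBetti S (2 * 1)} (hd : d ∈ algebraicClasses S 1) :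
    η d ∈ Submodule.span ℂ ((fun a : K3Index → ℚ => fun i => (a i : ℂ)) ''
      (k3FormRat.orthogonal W : Set (K3Index → ℚ))) := by
  have hspan := supportedClasses_eq_span_isRationalClass hS.isSmoothProjective (2 * 1) 1
  change algebraicClasses S 1 = Submodule.span ℂ
    {c : complexBetti S (2 * 1) | IsRationalClass c ∧ c ∈ algebraicClasses S 1} at hspan
  have hle : algebraicClasses S 1 ≤ (Submodule.span ℂ ((fun a : K3Index → ℚ => fun i => (a i : ℂ)) ''
      (k3FormRat.orthogonal W : Set (K3Index → ℚ)))).comap (η : complexBetti S (2 * 1) →ₗ[ℂ] (K3Index → ℂ)) := by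
    rw [hspan, Submodule.span_le]
    rintro c ⟨hcrat, hcN⟩
    obtain ⟨v, hv⟩ := (isRationalClass_iff_of_marking hS η hη c).1 hcrat
    have hc11 : IsOfHodgeType 2 S (2 * 1) 1 1 c :=
      isOfHodgeType_of_mem_algebraicClasses_of_isSmoothProjective hS.isSmoothProjective 1 hcN
    have hcx := ((oneOne_iff_of_marking hS hp0 hη hcup h20 hxpos c).1 hc11).1
    rw [hv] at hcx
    rw [SetLike.mem_coe, Submodule.mem_comap, LinearEquiv.coe_coe, hv]
    exact Submodule.subset_span ⟨v, ratCast_mem_orthogonal_of_k3Form_period hWc hx hirr hcx, rfl⟩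
  exact hle hd

/-- **`η⁻¹(W^⊥) ⊆ N¹(S)`**: a rational vector of `W^⊥` is `⊥ x, x̄ ∈ W ⊗ ℂ`, i.e. `η⁻¹` of it is a rational
`(1,1)`-class, algebraic by Lefschetz `(1,1)`. [cite: VoisinHodgeI2002, Thm. 11.30] [cite: Huybrechts2016K3, Ch. 3 §2] -/
theorem symm_ratCast_mem_algebraicClasses (hS : IsK3Surface S) (hp0 : p ≠ 0)
    (hη : ∀ c : complexBetti S (2 * 1), IsIntegralClass c ↔ ∃ v : K3Index → ℤ, η c = fun i => (v i : ℂ))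
    (hcup : ∀ a b : complexBetti S (2 * 1), cupProduct (rfl : 2 * 1 + 2 * 1 = 2 * 2) a b = k3Form (η a) (η b) • p)
    (h20 : IsOfHodgeType 2 S (2 * 1) 2 0 (η.symm x)) (hxpos : 0 < (k3Form (star x) x).re)
    (hx : x ∈ Submodule.span ℂ ((fun a : K3Index → ℚ => fun i => (a i : ℂ)) '' (W : Set (K3Index → ℚ))))
    (hxbar : star x ∈ Submodule.span ℂ ((fun a : K3Index → ℚ => fun i => (a i : ℂ)) '' (W : Set (K3Index → ℚ))))
    {m : K3Index → ℚ} (hm : m ∈ k3FormRat.orthogonal W) :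
    η.symm (fun i => (m i : ℂ)) ∈ algebraicClasses S 1 := by
  have hMW : ∀ m' ∈ k3FormRat.orthogonal W, ∀ w ∈ W, k3FormRat m' w = 0 := fun m' hm' w hw => by
    rw [k3FormRat_isSymm.eq]; exact (LinearMap.BilinForm.mem_orthogonal_iff.1 hm') w hw
  have hmspan : (fun i => (m i : ℂ)) ∈ Submodule.span ℂ ((fun a : K3Index → ℚ => fun i => (a i : ℂ)) ''
      (k3FormRat.orthogonal W : Set (K3Index → ℚ))) := Submodule.subset_span ⟨m, hm, rfl⟩
  have hrat : IsRationalClass (η.symm (fun i => (m i : ℂ))) :=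
    (isRationalClass_iff_of_marking hS η hη _).2 ⟨m, η.apply_symm_apply _⟩
  have h11 : IsOfHodgeType 2 S (2 * 1) 1 1 (η.symm (fun i => (m i : ℂ))) := by
    rw [oneOne_iff_of_marking hS hp0 hη hcup h20 hxpos, LinearEquiv.apply_symm_apply]
    exact ⟨k3Form_eq_zero_of_mem_span W _ hMW hmspan hx, k3Form_eq_zero_of_mem_span W _ hMW hmspan hxbar⟩
  exact lefschetzOneOne_rational_holds hS.isSmoothProjective _ hrat h11

/-- **A cup-transcendental class has `η a ∈ W ⊗ ℂ`**: it is cup-orthogonal to `η⁻¹(W^⊥) ⊆ N¹(S)`, i.e.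
`η a ⊥ W^⊥`, and `(W^⊥ ⊗ ℂ)^⊥ = W ⊗ ℂ`. [cite: Huybrechts2016K3, Ch. 3 Def. 2.5 and Lemma 3.1] -/
theorem eta_mem_span_of_cupTransc (hS : IsK3Surface S) (hp0 : p ≠ 0)
    (hη : ∀ c : complexBetti S (2 * 1), IsIntegralClass c ↔ ∃ v : K3Index → ℤ, η c = fun i => (v i : ℂ))
    (hcup : ∀ a b : complexBetti S (2 * 1), cupProduct (rfl : 2 * 1 + 2 * 1 = 2 * 2) a b = k3Form (η a) (η b) • p)
    (h20 : IsOfHodgeType 2 S (2 * 1) 2 0 (η.symm x)) (hxpos : 0 < (k3Form (star x) x).re)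
    (hx : x ∈ Submodule.span ℂ ((fun a : K3Index → ℚ => fun i => (a i : ℂ)) '' (W : Set (K3Index → ℚ))))
    (hxbar : star x ∈ Submodule.span ℂ ((fun a : K3Index → ℚ => fun i => (a i : ℂ)) '' (W : Set (K3Index → ℚ))))
    {a : complexBetti S (2 * 1)}
    (ha : ∀ d ∈ algebraicClasses S 1, cupProduct (rfl : 2 * 1 + 2 * 1 = 2 * 2) a d = 0) :
    η a ∈ Submodule.span ℂ ((fun v : K3Index → ℚ => fun i => (v i : ℂ)) '' (W : Set (K3Index → ℚ))) := by
  refine mem_span_ratCast_of_orthogonal W fun m hm => ?_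
  have h := ha _ (symm_ratCast_mem_algebraicClasses hS hp0 hη hcup h20 hxpos hx hxbar hm)
  rw [hcup, LinearEquiv.apply_symm_apply, smul_eq_zero, or_iff_left hp0] at h
  exact h

/-- **A class with `η a ∈ W ⊗ ℂ` is cup-transcendental** (`η(N¹(S)) ⊆ W^⊥ ⊗ ℂ`). [cite: Huybrechts2016K3, Ch. 3 Lemma 3.1] -/
theorem cupTransc_of_eta_mem_span (hS : IsK3Surface S) (hp0 : p ≠ 0)
    (hη : ∀ c : complexBetti S (2 * 1), IsIntegralClass c ↔ ∃ v : K3Index → ℤ, η c = fun i => (v i : ℂ))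
    (hcup : ∀ a b : complexBetti S (2 * 1), cupProduct (rfl : 2 * 1 + 2 * 1 = 2 * 2) a b = k3Form (η a) (η b) • p)
    (h20 : IsOfHodgeType 2 S (2 * 1) 2 0 (η.symm x)) (hxpos : 0 < (k3Form (star x) x).re)
    (hWc : IsCompl W (k3FormRat.orthogonal W))
    (hx : x ∈ Submodule.span ℂ ((fun a : K3Index → ℚ => fun i => (a i : ℂ)) '' (W : Set (K3Index → ℚ))))
    (hirr : ∀ w ∈ W, k3Form (fun i => (w i : ℂ)) x = 0 → w = 0)
    {a : complexBetti S (2 * 1)}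
    (ha : η a ∈ Submodule.span ℂ ((fun v : K3Index → ℚ => fun i => (v i : ℂ)) '' (W : Set (K3Index → ℚ)))) :
    ∀ d ∈ algebraicClasses S 1, cupProduct (rfl : 2 * 1 + 2 * 1 = 2 * 2) a d = 0 := by
  intro d hd
  have hMW : ∀ m' ∈ k3FormRat.orthogonal W, ∀ w ∈ W, k3FormRat m' w = 0 := fun m' hm' w hw => by
    rw [k3FormRat_isSymm.eq]; exact (LinearMap.BilinForm.mem_orthogonal_iff.1 hm') w hw
  rw [hcup, k3Form_comm, k3Form_eq_zero_of_mem_span W _ hMW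
    (eta_algebraic_mem_span_orthogonal hS hp0 hη hcup h20 hxpos hWc hx hirr hd) ha, zero_smul]

/-- **`dim_ℚ W^⊥ ≤ ρ(S)`**: `η⁻¹(W^⊥ ⊗ ℂ) ⊆ N¹(S)` and `dim_ℂ (W^⊥ ⊗ ℂ) = dim_ℚ W^⊥`.
[cite: Huybrechts2016K3, Ch. 1 §3.3 and Ch. 3 §2] -/
theorem le_finrank_algebraicClasses_of_marking (hS : IsK3Surface S) (hp0 : p ≠ 0)
    (hη : ∀ c : complexBetti S (2 * 1), IsIntegralClass c ↔ ∃ v : K3Index → ℤ, η c = fun i => (v i : ℂ))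
    (hcup : ∀ a b : complexBetti S (2 * 1), cupProduct (rfl : 2 * 1 + 2 * 1 = 2 * 2) a b = k3Form (η a) (η b) • p)
    (h20 : IsOfHodgeType 2 S (2 * 1) 2 0 (η.symm x)) (hxpos : 0 < (k3Form (star x) x).re)
    (hx : x ∈ Submodule.span ℂ ((fun a : K3Index → ℚ => fun i => (a i : ℂ)) '' (W : Set (K3Index → ℚ))))
    (hxbar : star x ∈ Submodule.span ℂ ((fun a : K3Index → ℚ => fun i => (a i : ℂ)) '' (W : Set (K3Index → ℚ)))) :
    finrank ℚ (k3FormRat.orthogonal W) ≤ finrank ℂ (algebraicClasses S 1) := by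
  set MC := Submodule.span ℂ ((fun a : K3Index → ℚ => fun i => (a i : ℂ)) ''
    (k3FormRat.orthogonal W : Set (K3Index → ℚ))) with hMC
  have hle : MC.map (η.symm : (K3Index → ℂ) →ₗ[ℂ] complexBetti S (2 * 1)) ≤ algebraicClasses S 1 := by
    rw [hMC, Submodule.map_span, Submodule.span_le]
    rintro _ ⟨_, ⟨m, hm, rfl⟩, rfl⟩
    exact symm_ratCast_mem_algebraicClasses hS hp0 hη hcup h20 hxpos hx hxbar hm
  haveI : FiniteDimensional ℂ (complexBetti S (2 * 1)) := LinearEquiv.finiteDimensional η.symm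
  calc finrank ℚ (k3FormRat.orthogonal W) = finrank ℂ MC := (finrank_span_ratCast _).symm
    _ = finrank ℂ (MC.map (η.symm : (K3Index → ℂ) →ₗ[ℂ] complexBetti S (2 * 1))) :=
        (LinearEquiv.finrank_map_eq η.symm MC).symm
    _ ≤ finrank ℂ (algebraicClasses S 1) := Submodule.finrank_mono hle

end Summit.HodgeConjecture.HodgeConjecture.Theorems.MarkmanPartnerTransport.PartnerLattice

end
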